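import Mathlib
import Summits.ValiantsHypothesis.ValiantsHypothesis.Theorems.LacunarySymmetroidMatrixDescartesStubInertiaChain
import Summits.ValiantsHypothesis.ValiantsHypothesis.Theorems.LacunarySymmetroidMatrixDescartesStubNegRoots
import Summits.ValiantsHypothesis.ValiantsHypothesis.Theorems.LacunarySymmetroidMatrixDescartesStubArith4

/-!
# `MatrixDescartes` (stmt-ValiantsHypothesis-18050) — the ONE-ALTERNATION matrix Descartes rule
# (semidefinite letters, arbitrary symmetric letters at the pivot exponent): `Z₊ ≤ m`, K-free

HONEST FRAMING.  Cell `pub-symmetroid`, seat `val-sym-mdr-p2`; helper file `--supports` the crux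
`Theses.LacunarySymmetroid.MatrixDescartes`.  A SECTOR theorem: it bounds the positive zeros of one structural
class of lacunary symmetric pencils (and the crux's inequality on the corresponding format family), decides
nothing about the crux in general, nothing about the registers `DoorA26` / `DoorA34`, nothing about `VP ≠ VNP`.

THE RULE (`oneAlternation`).  Let `F = ∑ₖ X^{dₖ} Sₖ` be a lacunary pencil of real symmetric `ι × ι` matrices
and `e ∈ ℕ` a pivot exponent such that every coefficient with `dₖ < e` is positive semidefinite and every
coefficient with `dₖ > e` is negative semidefinite; the coefficients with `dₖ = e` are ARBITRARY real symmetric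
matrices (any number of them).  Then `det F` has at most `card ι` distinct positive zeros — for any number of
terms and any exponents.  Mirror form (`oneAlternation_mirror`): negative semidefinite below, positive
semidefinite above.  This is the matrix Descartes rule for ONE alternation of signs: it contains the line
`Lift`'s first rung `firstRung_oneSided` (one arbitrary letter at an END, all other letters positive
semidefinite — the special case in which one side of the pivot is empty) and the case `α(P) = 1` of
Cameron–Psarrakos' generalized Descartes rule `z₊(P) ≤ n·α(P)` [CameronPsarrakos2019, Operators and Matrices 13
(2019) 643–652, doi:10.7153/oam-2019-13-48, Lemma 6: `α ∈ {0, 1, m}`, coefficients positive/negative DEFINITE or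
null, proved there by Markus' factorisation], here for SEMIdefinite letters, with indefinite letters allowed at
the pivot exponent, and counting distinct zeros.  It is tight (`X·I − diag(1,…,n)`), K-free, and NOT a monomial
count.  The two-alternation analogue is false already at `2 × 2` (tree `cameronPsarrakos_counterexample`,
`not_definiteLaw_two`: six positive zeros), so one alternation is exactly the K-free frontier on this side.

IN THE CRUX'S CURRENCY (`oneAlternation_realRoots`, `oneAlternation_mdr`).  If both `F(X)` and the reflected
pencil `F(−X) = ∑ₖ X^{dₖ} ((−1)^{dₖ} Sₖ)` are one-alternation words (e.g. all exponents even), then `det F` has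
at most `2·card ι + 1` distinct real zeros (tree `stub_negRoots`), and in the crux's regime
`m ≤ 2^((⌊log₂K⌋+c)^c)` this gives `Z^q ≤ 2^(K⌊log₂K⌋)` for all large `K` (tree `stub_arith4`-type
arithmetic): a second format family, after the low-rank sector, on which the inequality of `MatrixDescartes`
is a theorem at every admissible size.

PROOF (Loewner monotonicity + kernel chain, as for the first rung).  For `s > 0` put
`cₖ(s) = s^{dₖ−e}·(s⁻¹)^{e−dₖ}` (truncated subtractions: `= s^{dₖ−e}` as a real power) and
`G(s) = ∑ₖ cₖ(s) Sₖ`, so that `F(s) = s^e G(s)` (`OneAlternation.eval_det_pencil`).  Each summand of `G` is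
Loewner non-increasing in `s` (`cₖ` decreasing with `Sₖ ⪰ 0` below the pivot, increasing with `Sₖ ⪯ 0`
above, constant at the pivot), so `−G` is non-decreasing (`OneAlternation.family_mono`).  At a positive root
`t₀` of `det F` pick `v ≠ 0` with `G(t₀)v = 0`; for `s > t₀`, `vᵀG(s)v ≤ 0` termwise, and `= 0` would force
`Sₖv = 0` for every `dₖ ≠ e`, hence `G(s')v = G(t₀)v = 0` for all `s'`, i.e. `det F` vanishes on `(0,∞)`
(`OneAlternation.kernelData`).  The kernel vectors at the distinct positive roots are then linearly independent
(tree `stub_inertiaChain`, applied to `−G`), so there are at most `card ι` of them.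
Elementary; Mathlib + tree lemmas; axioms `propext`, `Classical.choice`, `Quot.sound`.
-/

-- layout Summits/ValiantsHypothesis/ValiantsHypothesis forces the duplicated namespace component
set_option linter.dupNamespace false

namespace Summit.ValiantsHypothesis.ValiantsHypothesis.Theorems.LacunarySymmetroidMatrixDescartes

open Polynomial Matrix Finset
open scoped BigOperators

namespace OneAlternation

variable {ι κ : Type*} [Fintype ι] [Fintype κ]

/-- The real coefficient `cₖ(s) = s^{n−e}·(s⁻¹)^{e−n}` (truncated subtractions) satisfies
`s^e · cₖ(s) = s^n` for `s ≠ 0`. [folklore] -/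
theorem pow_mul_coeff (e n : ℕ) (s : ℝ) (hs : s ≠ 0) :
    s ^ e * (s ^ (n - e) * (s⁻¹) ^ (e - n)) = s ^ n := by
  rcases le_total e n with h | h
  · rw [Nat.sub_eq_zero_of_le h, pow_zero, mul_one, ← pow_add, Nat.add_sub_cancel' h]
  · rw [Nat.sub_eq_zero_of_le h, pow_zero, one_mul, inv_pow, ← pow_sub₀ _ hs (Nat.sub_le e n),
      Nat.sub_sub_self h]

/-- Entrywise evaluation: at a real point `s ≠ 0` the polynomial matrix `∑ₖ X^{dₖ} • Sₖ` evaluates to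
`s^e • ∑ₖ cₖ(s) • Sₖ`. [folklore] -/
theorem evalRingHom_mapMatrix_pencil [DecidableEq ι] (e : ℕ) (d : κ → ℕ) (S : κ → Matrix ι ι ℝ)
    (s : ℝ) (hs : s ≠ 0) :
    (Polynomial.evalRingHom s).mapMatrix
        (∑ k, ((Polynomial.X : Polynomial ℝ) ^ d k) • (S k).map Polynomial.C)
      = s ^ e • ∑ k, (s ^ (d k - e) * (s⁻¹) ^ (e - d k)) • S k := by
  ext i j
  simp only [RingHom.mapMatrix_apply, Matrix.map_apply, Matrix.smul_apply, Matrix.sum_apply,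
    smul_eq_mul, Polynomial.coe_evalRingHom, Polynomial.eval_mul, Polynomial.eval_pow,
    Polynomial.eval_X, Polynomial.eval_C, Polynomial.eval_finsetSum, Finset.mul_sum]
  refine Finset.sum_congr rfl fun k _ => ?_
  rw [← mul_assoc, pow_mul_coeff e (d k) s hs]

/-- Evaluating the determinant: `(det ∑ₖ X^{dₖ} Sₖ)(s) = s^(e·card ι) · det (∑ₖ cₖ(s) Sₖ)` for
`s ≠ 0`. [folklore] -/
theorem eval_det_pencil [DecidableEq ι] (e : ℕ) (d : κ → ℕ) (S : κ → Matrix ι ι ℝ) (s : ℝ)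
    (hs : s ≠ 0) :
    (Matrix.det (∑ k, ((Polynomial.X : Polynomial ℝ) ^ d k) • (S k).map Polynomial.C)).eval s
      = s ^ (e * Fintype.card ι) * (∑ k, (s ^ (d k - e) * (s⁻¹) ^ (e - d k)) • S k).det := by
  have h := RingHom.map_det (Polynomial.evalRingHom s)
    (∑ k, ((Polynomial.X : Polynomial ℝ) ^ d k) • (S k).map Polynomial.C)
  rw [Polynomial.coe_evalRingHom] at h
  rw [h, evalRingHom_mapMatrix_pencil e d S s hs, Matrix.det_smul, pow_mul]

/-- The family `G(s) = ∑ₖ cₖ(s) • Sₖ` applied to a vector. [folklore] -/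
theorem family_mulVec (c : κ → ℝ) (S : κ → Matrix ι ι ℝ) (v : ι → ℝ) :
    (∑ k, c k • S k) *ᵥ v = ∑ k, c k • (S k *ᵥ v) := by
  rw [Matrix.sum_mulVec]
  simp only [Matrix.smul_mulVec]

/-- The quadratic form of `G(s) = ∑ₖ cₖ(s) • Sₖ` at `v`: `∑ₖ cₖ(s) · vᵀSₖv`. [folklore] -/
theorem dotProduct_family_mulVec (c : κ → ℝ) (S : κ → Matrix ι ι ℝ) (v : ι → ℝ) :
    v ⬝ᵥ ((∑ k, c k • S k) *ᵥ v) = ∑ k, c k * (v ⬝ᵥ (S k *ᵥ v)) := by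
  rw [family_mulVec, dotProduct_sum]
  simp only [dotProduct_smul, smul_eq_mul]

omit [Fintype κ] in
/-- Below the pivot the coefficient `cₖ` is `(s⁻¹)^{e−dₖ}`, non-increasing on `s > 0`; above it is
`s^{dₖ−e}`, non-decreasing; so `(cₖ(t) − cₖ(s))·vᵀSₖv ≤ 0` termwise for `0 < s ≤ t` under the
one-alternation sign hypotheses. [folklore] -/
theorem term_nonpos (e : ℕ) (d : κ → ℕ) (S : κ → Matrix ι ι ℝ)
    (hlo : ∀ k, d k < e → (S k).PosSemidef) (hhi : ∀ k, e < d k → (-S k).PosSemidef)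
    (v : ι → ℝ) (s t : ℝ) (hs : 0 < s) (hst : s ≤ t) (k : κ) :
    (t ^ (d k - e) * (t⁻¹) ^ (e - d k) - s ^ (d k - e) * (s⁻¹) ^ (e - d k)) * (v ⬝ᵥ (S k *ᵥ v))
      ≤ 0 := by
  rcases lt_trichotomy (d k) e with hlt | heq | hgt
  · -- below the pivot: coefficient non-increasing, `vᵀ S v ≥ 0`
    have hq : 0 ≤ v ⬝ᵥ (S k *ᵥ v) := by
      simpa only [star_trivial] using (hlo k hlt).dotProduct_mulVec_nonneg v
    have hc : t ^ (d k - e) * (t⁻¹) ^ (e - d k) ≤ s ^ (d k - e) * (s⁻¹) ^ (e - d k) := by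
      simp only [Nat.sub_eq_zero_of_le hlt.le, pow_zero, one_mul]
      exact pow_le_pow_left₀ (inv_nonneg.2 (hs.le.trans hst)) (inv_anti₀ hs hst) _
    exact mul_nonpos_of_nonpos_of_nonneg (sub_nonpos.2 hc) hq
  · simp only [heq, Nat.sub_self, pow_zero, mul_one, sub_self, zero_mul, le_refl]
  · -- above the pivot: coefficient non-decreasing, `vᵀ S v ≤ 0`
    have hq : v ⬝ᵥ (S k *ᵥ v) ≤ 0 := by
      have h := (hhi k hgt).dotProduct_mulVec_nonneg v
      rw [star_trivial, Matrix.neg_mulVec, dotProduct_neg] at h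
      linarith
    have hc : s ^ (d k - e) * (s⁻¹) ^ (e - d k) ≤ t ^ (d k - e) * (t⁻¹) ^ (e - d k) := by
      simp only [Nat.sub_eq_zero_of_le hgt.le, pow_zero, mul_one]
      exact pow_le_pow_left₀ hs.le hst _
    exact mul_nonpos_of_nonneg_of_nonpos (sub_nonneg.2 hc) hq

/-- **Loewner monotonicity**: under the one-alternation hypotheses the family `−G`,
`G(s) = ∑ₖ cₖ(s) • Sₖ`, is non-decreasing on `s > 0`. [folklore] -/
theorem family_mono (e : ℕ) (d : κ → ℕ) (S : κ → Matrix ι ι ℝ) (hS : ∀ k, (S k).IsSymm)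
    (hlo : ∀ k, d k < e → (S k).PosSemidef) (hhi : ∀ k, e < d k → (-S k).PosSemidef)
    (s t : ℝ) (hs : 0 < s) (hst : s ≤ t) :
    (-(∑ k, (t ^ (d k - e) * (t⁻¹) ^ (e - d k)) • S k)
      - -(∑ k, (s ^ (d k - e) * (s⁻¹) ^ (e - d k)) • S k)).PosSemidef := by
  refine Matrix.PosSemidef.of_dotProduct_mulVec_nonneg ?_ fun x => ?_
  · -- symmetric
    have hsym : ∀ u : ℝ, (∑ k, (u ^ (d k - e) * (u⁻¹) ^ (e - d k)) • S k).IsSymm := by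
      intro u
      unfold Matrix.IsSymm
      rw [Matrix.transpose_sum]
      exact Finset.sum_congr rfl fun k _ => by rw [Matrix.transpose_smul, (hS k).eq]
    have h : (-(∑ k, (t ^ (d k - e) * (t⁻¹) ^ (e - d k)) • S k)
        - -(∑ k, (s ^ (d k - e) * (s⁻¹) ^ (e - d k)) • S k)).IsSymm := by
      unfold Matrix.IsSymm
      rw [Matrix.transpose_sub, Matrix.transpose_neg, Matrix.transpose_neg, (hsym t).eq, (hsym s).eq]
    exact Matrix.isHermitian_iff_isSymm.2 h
  · rw [star_trivial, neg_sub_neg, Matrix.sub_mulVec, dotProduct_sub, dotProduct_family_mulVec,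
      dotProduct_family_mulVec, ← Finset.sum_sub_distrib]
    refine Finset.sum_nonneg fun k _ => ?_
    rw [← sub_mul]
    have h := term_nonpos e d S hlo hhi x s t hs hst k
    linarith

/-- **Kernel data at a positive root.**  If `det F ≠ 0` (`F = ∑ₖ X^{dₖ} Sₖ` a one-alternation word)
and `t₀ > 0` is a root of `det F`, there is `v ≠ 0` with `G(t₀) v = 0` and `vᵀ G(s) v < 0` for every
`s > t₀`. [folklore] -/
theorem kernelData [DecidableEq ι] (e : ℕ) (d : κ → ℕ) (S : κ → Matrix ι ι ℝ)
    (hlo : ∀ k, d k < e → (S k).PosSemidef) (hhi : ∀ k, e < d k → (-S k).PosSemidef)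
    (hdet : Matrix.det (∑ k, ((Polynomial.X : Polynomial ℝ) ^ d k) • (S k).map Polynomial.C) ≠ 0)
    (t₀ : ℝ) (ht₀ : 0 < t₀)
    (hroot : (Matrix.det (∑ k, ((Polynomial.X : Polynomial ℝ) ^ d k) •
      (S k).map Polynomial.C)).IsRoot t₀) :
    ∃ v : ι → ℝ, v ≠ 0 ∧ (∑ k, (t₀ ^ (d k - e) * (t₀⁻¹) ^ (e - d k)) • S k) *ᵥ v = 0 ∧
      ∀ s : ℝ, t₀ < s → v ⬝ᵥ ((∑ k, (s ^ (d k - e) * (s⁻¹) ^ (e - d k)) • S k) *ᵥ v) < 0 := by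
  -- Step 1: `det G(t₀) = 0`
  have hdet0 : (∑ k, (t₀ ^ (d k - e) * (t₀⁻¹) ^ (e - d k)) • S k).det = 0 := by
    have h1 : (Matrix.det (∑ k, ((Polynomial.X : Polynomial ℝ) ^ d k) •
        (S k).map Polynomial.C)).eval t₀ = 0 := hroot
    rw [eval_det_pencil e d S t₀ ht₀.ne'] at h1
    exact (mul_eq_zero.1 h1).resolve_left (pow_ne_zero _ ht₀.ne')
  -- Step 2: a nonzero kernel vector
  obtain ⟨v, hv, hGv⟩ := Matrix.exists_mulVec_eq_zero_iff.2 hdet0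
  refine ⟨v, hv, hGv, fun s hs => ?_⟩
  -- Step 3: the quadratic form at `s > t₀` is a sum of nonpositive terms
  have hquad0 : ∑ k, t₀ ^ (d k - e) * (t₀⁻¹) ^ (e - d k) * (v ⬝ᵥ (S k *ᵥ v)) = 0 := by
    rw [← dotProduct_family_mulVec, hGv, dotProduct_zero]
  have hquad : v ⬝ᵥ ((∑ k, (s ^ (d k - e) * (s⁻¹) ^ (e - d k)) • S k) *ᵥ v)
      = ∑ k, (s ^ (d k - e) * (s⁻¹) ^ (e - d k) - t₀ ^ (d k - e) * (t₀⁻¹) ^ (e - d k))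
          * (v ⬝ᵥ (S k *ᵥ v)) := by
    rw [dotProduct_family_mulVec]
    simp only [sub_mul, Finset.sum_sub_distrib, hquad0, sub_zero]
  have hterm : ∀ k, (s ^ (d k - e) * (s⁻¹) ^ (e - d k) - t₀ ^ (d k - e) * (t₀⁻¹) ^ (e - d k))
      * (v ⬝ᵥ (S k *ᵥ v)) ≤ 0 := fun k => term_nonpos e d S hlo hhi v t₀ s ht₀ hs.le k
  have hnonpos : v ⬝ᵥ ((∑ k, (s ^ (d k - e) * (s⁻¹) ^ (e - d k)) • S k) *ᵥ v) ≤ 0 := by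
    rw [hquad]
    exact Finset.sum_nonpos fun k _ => hterm k
  refine hnonpos.lt_of_ne fun hzero => ?_
  -- Step 4: if the form vanished at `s`, every summand vanishes ...
  rw [hquad, Finset.sum_eq_zero_iff_of_nonpos (fun k _ => hterm k)] at hzero
  -- ... so `Sₖ v = 0` off the pivot, and each term `cₖ(s') • Sₖ v` is independent of `s'`
  have hk : ∀ (k : κ) (s' : ℝ), (s' ^ (d k - e) * (s'⁻¹) ^ (e - d k)) • (S k *ᵥ v)
      = (t₀ ^ (d k - e) * (t₀⁻¹) ^ (e - d k)) • (S k *ᵥ v) := by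
    intro k s'
    rcases lt_trichotomy (d k) e with hlt | heq | hgt
    · have hclt : s ^ (d k - e) * (s⁻¹) ^ (e - d k) < t₀ ^ (d k - e) * (t₀⁻¹) ^ (e - d k) := by
        simp only [Nat.sub_eq_zero_of_le hlt.le, pow_zero, one_mul]
        exact pow_lt_pow_left₀ (inv_strictAnti₀ ht₀ hs) (inv_nonneg.2 (ht₀.le.trans hs.le))
          (Nat.sub_ne_zero_of_lt hlt)
      have hqk : v ⬝ᵥ (S k *ᵥ v) = 0 :=
        (mul_eq_zero.1 (hzero k (Finset.mem_univ k))).resolve_left (sub_neg.2 hclt).ne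
      have hSv : S k *ᵥ v = 0 := by
        have h := (hlo k hlt).dotProduct_mulVec_zero_iff v
        rw [star_trivial] at h
        exact h.1 hqk
      rw [hSv, smul_zero, smul_zero]
    · simp only [heq, Nat.sub_self, pow_zero]
    · have hclt : t₀ ^ (d k - e) * (t₀⁻¹) ^ (e - d k) < s ^ (d k - e) * (s⁻¹) ^ (e - d k) := by
        simp only [Nat.sub_eq_zero_of_le hgt.le, pow_zero, mul_one]
        exact pow_lt_pow_left₀ hs ht₀.le (Nat.sub_ne_zero_of_lt hgt)
      have hqk : v ⬝ᵥ (S k *ᵥ v) = 0 :=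
        (mul_eq_zero.1 (hzero k (Finset.mem_univ k))).resolve_left (sub_pos.2 hclt).ne'
      have hSv : S k *ᵥ v = 0 := by
        have h := (hhi k hgt).dotProduct_mulVec_zero_iff v
        rw [star_trivial, Matrix.neg_mulVec, dotProduct_neg, neg_eq_zero] at h
        have h2 := h.1 hqk
        rwa [neg_eq_zero] at h2
      rw [hSv, smul_zero, smul_zero]
  -- ... hence `G(s') v = G(t₀) v = 0` for every real `s'` ...
  have hGs' : ∀ s' : ℝ, (∑ k, (s' ^ (d k - e) * (s'⁻¹) ^ (e - d k)) • S k) *ᵥ v = 0 := by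
    intro s'
    rw [← hGv, family_mulVec, family_mulVec]
    exact Finset.sum_congr rfl fun k _ => hk k s'
  -- ... so `det G(s') = 0` for every `s'`, and `det F` vanishes at every positive real: `det F = 0`.
  have hdet' : ∀ s' : ℝ, (∑ k, (s' ^ (d k - e) * (s'⁻¹) ^ (e - d k)) • S k).det = 0 := fun s' =>
    Matrix.exists_mulVec_eq_zero_iff.1 ⟨v, hv, hGs' s'⟩
  refine hdet (Polynomial.eq_zero_of_infinite_isRoot _ ((Set.Ioi_infinite (0 : ℝ)).mono ?_))
  intro s' hs'
  have hs'0 : (s' : ℝ) ≠ 0 := (Set.mem_Ioi.1 hs').ne'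
  show (Matrix.det (∑ k, ((Polynomial.X : Polynomial ℝ) ^ d k) •
      (S k).map Polynomial.C)).IsRoot s'
  rw [Polynomial.IsRoot, eval_det_pencil e d S s' hs'0, hdet' s', mul_zero]

end OneAlternation

/-- **ONE-ALTERNATION MATRIX DESCARTES RULE** (semidefinite letters, arbitrary symmetric letters at the
pivot exponent; K-free).  Let `Sₖ` be real symmetric `ι × ι` matrices with exponents `dₖ` and let `e` be
a pivot exponent such that `Sₖ ⪰ 0` whenever `dₖ < e` and `Sₖ ⪯ 0` whenever `dₖ > e` (no condition when
`dₖ = e`).  Then `det (∑ₖ X^{dₖ} Sₖ)` has at most `card ι` distinct positive zeros, for any number of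
terms.  Generalises the first rung `firstRung_oneSided` (one side of the pivot empty) and the case
`α = 1` of [CameronPsarrakos2019, Lemma 6] (definite-or-null coefficients) to semidefinite letters with
indefinite pivot letters; tight by `X·I − diag(1,…,n)`. [cite: CameronPsarrakos2019, Lemma 6] -/
theorem oneAlternation (ι κ : Type) [Fintype ι] [DecidableEq ι] [Fintype κ] (e : ℕ) (d : κ → ℕ)
    (S : κ → Matrix ι ι ℝ) (hS : ∀ k, (S k).IsSymm) (hlo : ∀ k, d k < e → (S k).PosSemidef)
    (hhi : ∀ k, e < d k → (-S k).PosSemidef) :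
    ((Matrix.det (∑ k, ((Polynomial.X : Polynomial ℝ) ^ d k) • (S k).map Polynomial.C)
        ).roots.toFinset.filter (fun t => 0 < t)).card ≤ Fintype.card ι := by
  set p := Matrix.det (∑ k, ((Polynomial.X : Polynomial ℝ) ^ d k) • (S k).map Polynomial.C)
    with hp
  by_cases hdet : p = 0
  · simp [hdet]
  -- enumerate the positive roots increasingly
  set R := p.roots.toFinset.filter (fun t => 0 < t) with hR
  let τ : Fin R.card ↪o ℝ := R.orderEmbOfFin rfl
  have hτmem : ∀ j, τ j ∈ R := fun j => R.orderEmbOfFin_mem rfl j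
  have hτpos : ∀ j, 0 < τ j := fun j => (Finset.mem_filter.1 (hτmem j)).2
  have hτroot : ∀ j, p.IsRoot (τ j) := fun j => by
    have h1 := (Finset.mem_filter.1 (hτmem j)).1
    rw [Multiset.mem_toFinset] at h1
    exact (Polynomial.mem_roots hdet).1 h1
  -- kernel data at each root
  have hdata : ∀ j, ∃ v : ι → ℝ, v ≠ 0 ∧
      (∑ k, (τ j ^ (d k - e) * ((τ j)⁻¹) ^ (e - d k)) • S k) *ᵥ v = 0 ∧
      ∀ s : ℝ, τ j < s → v ⬝ᵥ ((∑ k, (s ^ (d k - e) * (s⁻¹) ^ (e - d k)) • S k) *ᵥ v) < 0 :=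
    fun j => OneAlternation.kernelData e d S hlo hhi hdet (τ j) (hτpos j) (hτroot j)
  choose v _hv0 hker hneg using hdata
  -- the Loewner-monotone family `−G`
  have hsym : ∀ u : ℝ, (∑ k, (u ^ (d k - e) * (u⁻¹) ^ (e - d k)) • S k).IsSymm := by
    intro u
    unfold Matrix.IsSymm
    rw [Matrix.transpose_sum]
    exact Finset.sum_congr rfl fun k _ => by rw [Matrix.transpose_smul, (hS k).eq]
  have hG : ∀ u : ℝ, (-(∑ k, (u ^ (d k - e) * (u⁻¹) ^ (e - d k)) • S k)).IsSymm := fun u => by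
    unfold Matrix.IsSymm
    rw [Matrix.transpose_neg, (hsym u).eq]
  have hker' : ∀ j, (-(∑ k, (τ j ^ (d k - e) * ((τ j)⁻¹) ^ (e - d k)) • S k)) *ᵥ v j = 0 :=
    fun j => by rw [Matrix.neg_mulVec, hker j, neg_zero]
  have hpos : ∀ j (s : ℝ), τ j < s →
      0 < v j ⬝ᵥ ((-(∑ k, (s ^ (d k - e) * (s⁻¹) ^ (e - d k)) • S k)) *ᵥ v j) := by
    intro j s hs
    rw [Matrix.neg_mulVec, dotProduct_neg]
    exact neg_pos.2 (hneg j s hs)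
  exact stub_inertiaChain ι (fun u => -(∑ k, (u ^ (d k - e) * (u⁻¹) ^ (e - d k)) • S k)) hG
    (fun s t hs hst => OneAlternation.family_mono e d S hS hlo hhi s t hs hst) R.card τ
    τ.strictMono hτpos v hker' hpos

/-- Negating every coefficient does not change the zeros of the determinant. [folklore] -/
theorem roots_det_pencil_neg {ι κ : Type} [Fintype ι] [DecidableEq ι] [Fintype κ] (d : κ → ℕ)
    (S : κ → Matrix ι ι ℝ) :
    (Matrix.det (∑ k, ((Polynomial.X : Polynomial ℝ) ^ d k) • (-S k).map Polynomial.C)).roots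
      = (Matrix.det (∑ k, ((Polynomial.X : Polynomial ℝ) ^ d k) • (S k).map Polynomial.C)).roots := by
  have h : (∑ k, ((Polynomial.X : Polynomial ℝ) ^ d k) • (-S k).map Polynomial.C)
      = -(∑ k, ((Polynomial.X : Polynomial ℝ) ^ d k) • (S k).map Polynomial.C) := by
    rw [← Finset.sum_neg_distrib]
    refine Finset.sum_congr rfl fun k _ => ?_
    rw [Matrix.map_neg _ (map_neg Polynomial.C), smul_neg]
  rw [h, Matrix.det_neg, ← Polynomial.C_1, ← Polynomial.C_neg, ← Polynomial.C_pow,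
    Polynomial.roots_C_mul _ (pow_ne_zero _ (neg_ne_zero.2 one_ne_zero))]

/-- **One-alternation rule, mirror form**: `Sₖ ⪯ 0` below the pivot and `Sₖ ⪰ 0` above (arbitrary
symmetric letters at the pivot) also give at most `card ι` distinct positive zeros (apply
`oneAlternation` to `−F`). [cite: CameronPsarrakos2019, Lemma 6] -/
theorem oneAlternation_mirror (ι κ : Type) [Fintype ι] [DecidableEq ι] [Fintype κ] (e : ℕ)
    (d : κ → ℕ) (S : κ → Matrix ι ι ℝ) (hS : ∀ k, (S k).IsSymm)
    (hlo : ∀ k, d k < e → (-S k).PosSemidef) (hhi : ∀ k, e < d k → (S k).PosSemidef) :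
    ((Matrix.det (∑ k, ((Polynomial.X : Polynomial ℝ) ^ d k) • (S k).map Polynomial.C)
        ).roots.toFinset.filter (fun t => 0 < t)).card ≤ Fintype.card ι := by
  rw [← roots_det_pencil_neg d S]
  exact oneAlternation ι κ e d (fun k => -S k) (fun k => (hS k).neg) hlo
    (fun k hk => by rw [neg_neg]; exact hhi k hk)

/-- **Real zeros of a two-way one-alternation word.**  If `F = ∑ₗ X^{dₗ} Sₗ` (real symmetric `m × m`
letters, `K` terms) is a one-alternation word for some pivot `e` and the reflected pencil
`F(−X) = ∑ₗ X^{dₗ} ((−1)^{dₗ} Sₗ)` is one for some pivot `e'`, then `det F` has at most `2m + 1` distinct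
real zeros (positive zeros of `F`, of `F(−X)`, and the origin; tree `stub_negRoots`). [folklore] -/
theorem oneAlternation_realRoots (K m e e' : ℕ) (d : Fin K → ℕ) (S : Fin K → Matrix (Fin m) (Fin m) ℝ)
    (hS : ∀ l, (S l).IsSymm) (hlo : ∀ l, d l < e → (S l).PosSemidef)
    (hhi : ∀ l, e < d l → (-S l).PosSemidef)
    (hlo' : ∀ l, d l < e' → (((-1 : ℝ) ^ d l) • S l).PosSemidef)
    (hhi' : ∀ l, e' < d l → (-(((-1 : ℝ) ^ d l) • S l)).PosSemidef) :
    (Matrix.det (∑ l, ((Polynomial.X : Polynomial ℝ) ^ d l) • (S l).map Polynomial.C)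
      ).roots.toFinset.card ≤ 2 * m + 1 := by
  have h1 := oneAlternation (Fin m) (Fin K) e d S hS hlo hhi
  have h2 := oneAlternation (Fin m) (Fin K) e' d (fun l => ((-1 : ℝ) ^ d l) • S l)
    (fun l => (hS l).smul _) hlo' hhi'
  have h3 := stub_negRoots K m d S
  rw [Fintype.card_fin] at h1 h2
  omega

/-- Regime arithmetic: in the crux's size range `m ≤ 2^((⌊log₂K⌋+c)^c)`, a root count `Z ≤ 2m + 1`
gives `Z^q ≤ 2^(K⌊log₂K⌋)` for all large `K`. [folklore] -/
theorem linearCount_absorbed (c q : ℕ) : ∃ K₁ : ℕ, ∀ K m Z : ℕ, K₁ ≤ K →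
    m ≤ 2 ^ ((Nat.log 2 K + c) ^ c) → Z ≤ 2 * m + 1 → Z ^ q ≤ 2 ^ (K * Nat.log 2 K) := by
  obtain ⟨K₁, hK₁⟩ := stub_arith4 c (2 * q)
  refine ⟨max K₁ (max 16 (2 * q)), fun K m Z hK hm hZ => ?_⟩
  have hK₁K : K₁ ≤ K := le_trans (le_max_left _ _) hK
  have hK16 : 16 ≤ K := le_trans (le_trans (le_max_left _ _) (le_max_right _ _)) hK
  have hKq : 2 * q ≤ K := le_trans (le_trans (le_max_right _ _) (le_max_right _ _)) hK
  have hlog : 4 ≤ Nat.log 2 K := by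
    calc 4 = Nat.log 2 16 := by decide
      _ ≤ Nat.log 2 K := Nat.log_mono_right hK16
  rcases le_or_gt 3 m with hm3 | hm3
  · -- `Z ≤ 2m+1 ≤ m²`, and `m^(2q)` is absorbed by the regime (`stub_arith4`)
    have hZm : Z ≤ m ^ 2 := by nlinarith
    calc Z ^ q ≤ (m ^ 2) ^ q := Nat.pow_le_pow_left hZm q
      _ = m ^ (2 * q) := by rw [← pow_mul]
      _ ≤ 2 ^ (K * Nat.log 2 K) := hK₁ K m hK₁K hm
  · -- `m ≤ 2`: `Z ≤ 5 < 2^3`, `Z^q ≤ 2^(3q) ≤ 2^(K log K)`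
    have hZ5 : Z ≤ 2 ^ 3 := by omega
    calc Z ^ q ≤ (2 ^ 3) ^ q := Nat.pow_le_pow_left hZ5 q
      _ = 2 ^ (3 * q) := by rw [← pow_mul]
      _ ≤ 2 ^ (K * Nat.log 2 K) := Nat.pow_le_pow_right (by norm_num) (by nlinarith)

/-- **The crux's inequality on two-way one-alternation words.**  For all `c, q` there is `K₀` such that
for all `K ≥ K₀`, all sizes `m ≤ 2^((⌊log₂K⌋+c)^c)`, all exponents `d` and all real symmetric `Sₗ` for
which `F(X)` and `F(−X)` are one-alternation words (pivots `e, e'`; semidefinite letters off the pivots,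
arbitrary letters at them), the number `Z` of distinct real zeros of `det (∑ₗ X^{dₗ} Sₗ)` satisfies
`Z^q ≤ 2^(K⌊log₂K⌋)` — the statement of `MatrixDescartes` restricted to this format family (every
admissible size, fat formats included).  Nothing is claimed outside the family. [folklore] -/
theorem oneAlternation_mdr (c q : ℕ) : ∃ K₀ : ℕ, ∀ K m : ℕ, K₀ ≤ K →
    m ≤ 2 ^ ((Nat.log 2 K + c) ^ c) → ∀ (e e' : ℕ) (d : Fin K → ℕ)
      (S : Fin K → Matrix (Fin m) (Fin m) ℝ), (∀ l, (S l).IsSymm) →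
      (∀ l, d l < e → (S l).PosSemidef) → (∀ l, e < d l → (-S l).PosSemidef) →
      (∀ l, d l < e' → (((-1 : ℝ) ^ d l) • S l).PosSemidef) →
      (∀ l, e' < d l → (-(((-1 : ℝ) ^ d l) • S l)).PosSemidef) →
      (Matrix.det (∑ l, ((Polynomial.X : Polynomial ℝ) ^ d l) • (S l).map Polynomial.C)
        ).roots.toFinset.card ^ q ≤ 2 ^ (K * Nat.log 2 K) := by
  obtain ⟨K₁, hK₁⟩ := linearCount_absorbed c q
  exact ⟨K₁, fun K m hK hm e e' d S hS hlo hhi hlo' hhi' =>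
    hK₁ K m _ hK hm (oneAlternation_realRoots K m e e' d S hS hlo hhi hlo' hhi')⟩

end Summit.ValiantsHypothesis.ValiantsHypothesis.Theorems.LacunarySymmetroidMatrixDescartes
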